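import Mathlib
import HarnessLib

/-!
# The order of a permutation group is controlled by its orbits

Topic `Literature/GroupTheory/PermutationGroups`.  Fully PROVED folklore facts used when bounding
orders of (Sylow subgroups of) permutation groups "orbit by orbit" (Wielandt's method, as used by
Praeger–Saxl 1980):

* `restrict_to_orbits_injective` — a group acting on `α` maps to the product of the symmetric
  groups of its orbits; the map is injective when the action is faithful.
* `card_dvd_prod_factorial_card_orbit` — hence `|H|` divides `∏_ω |ω|!` over the orbits `ω`.
* `sub_one_mul_factorization_factorial_le` — Legendre: `(p - 1) · v_p(m!) ≤ m - 1`.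
* `sub_one_mul_factorization_card_le` — consequently `(p - 1) · v_p(|H|) ≤ |α| - #orbits(H)`
  for a faithful action on a finite set; in particular (`…_perm`) for `H ≤ Sym(α)`.
* `card_subgroup_perm_dvd_factorial`, `prime_le_of_dvd_card` — `|H| ∣ |α|!`, so every prime
  divisor of `|H|` is at most `|α|`.
-/

namespace Literature.GroupTheory.PermutationGroups

open MulAction Equiv

section general

variable {H : Type*} [Group H] {α : Type*} [MulAction H α]

/-- Restriction to the orbits: the homomorphism from a group acting on `α` to the product, over
the orbits `ω`, of the symmetric groups `Sym(ω)` is injective when the action is faithful.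
(The homomorphism is `MonoidHom.pi fun ω => MulAction.toPermHom H ω.orbit`; we do not name it.)
[folklore] -/
theorem restrict_to_orbits_injective [FaithfulSMul H α] :
    Function.Injective
      (MonoidHom.pi fun ω : orbitRel.Quotient H α => MulAction.toPermHom H ω.orbit) := by
  intro h₁ h₂ he
  apply FaithfulSMul.eq_of_smul_eq_smul (α := α)
  intro a
  set ω : orbitRel.Quotient H α := Quotient.mk'' a
  have ha : a ∈ ω.orbit := orbitRel.Quotient.mem_orbit.mpr rfl
  have := congrArg (fun f => ((f ω ⟨a, ha⟩ : ω.orbit) : α)) he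
  simpa using this

variable [Finite α]

/-- A group acting faithfully on a finite set has order dividing `∏_ω |ω|!`, the product over its
orbits `ω`. [folklore] -/
theorem card_dvd_prod_factorial_card_orbit [FaithfulSMul H α] :
    Nat.card H ∣ ∏ᶠ ω : orbitRel.Quotient H α, (Nat.card ω.orbit).factorial := by
  classical
  have hfin : Fintype α := Fintype.ofFinite α
  have hdvd := Subgroup.card_dvd_of_injective _ (restrict_to_orbits_injective (H := H) (α := α))
  refine hdvd.trans ?_
  rw [Nat.card_pi, finprod_eq_prod_of_fintype]
  refine Finset.prod_dvd_prod_of_dvd _ _ fun ω _ => ?_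
  rw [Nat.card_perm]

/-- **Legendre**, weak form: `(p - 1) · v_p(m!) ≤ m - 1` (both sides `0` at `m = 0`). [folklore] -/
theorem sub_one_mul_factorization_factorial_le {p : ℕ} (hp : p.Prime) (m : ℕ) :
    (p - 1) * (m.factorial).factorization p ≤ m - 1 := by
  rcases Nat.eq_zero_or_pos m with rfl | hm
  · simp
  · haveI : Fact p.Prime := ⟨hp⟩
    rw [Nat.factorization_def _ hp]
    have := sub_one_mul_padicValNat_factorial_lt_of_ne_zero p hm.ne'
    omega

/-- The orbits of an action on a finite type partition it: `∑_ω |ω| = |α|`. [folklore] -/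
theorem sum_card_orbit_eq_card :
    ∑ᶠ ω : orbitRel.Quotient H α, Nat.card ω.orbit = Nat.card α := by
  classical
  have hfin : Fintype α := Fintype.ofFinite α
  rw [finsum_eq_sum_of_fintype, Nat.card_congr (MulAction.selfEquivSigmaOrbits' H α),
    Nat.card_sigma]

/-- **Order bound from orbits**: if `H` acts faithfully on the finite set `α` with `r` orbits,
then `(p - 1) · v_p(|H|) ≤ |α| - r` for every prime `p` — the `p`-part of `|H|` is at most that
of the product of the symmetric groups on the orbits. [folklore] -/
theorem sub_one_mul_factorization_card_le [FaithfulSMul H α] {p : ℕ} (hp : p.Prime) :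
    (p - 1) * (Nat.card H).factorization p ≤
      Nat.card α - Nat.card (orbitRel.Quotient H α) := by
  classical
  have hfin : Fintype α := Fintype.ofFinite α
  -- `H` is finite, being embedded in a finite product of finite symmetric groups
  have hHfin : Finite H :=
    Finite.of_injective _ (restrict_to_orbits_injective (H := H) (α := α))
  have hdvd := card_dvd_prod_factorial_card_orbit (H := H) (α := α)
  rw [finprod_eq_prod_of_fintype] at hdvd
  have hne : (∏ ω : orbitRel.Quotient H α, (Nat.card ω.orbit).factorial) ≠ 0 :=
    Finset.prod_ne_zero_iff.mpr fun ω _ => Nat.factorial_ne_zero _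
  have hle : (Nat.card H).factorization p ≤
      ∑ ω : orbitRel.Quotient H α, ((Nat.card ω.orbit).factorial).factorization p := by
    have h1 := (Nat.factorization_le_iff_dvd Nat.card_pos.ne' hne).mpr hdvd p
    rw [Nat.factorization_prod fun ω _ => Nat.factorial_ne_zero _] at h1
    simpa [Finset.sum_apply'] using h1
  have hsum := sum_card_orbit_eq_card (H := H) (α := α)
  rw [finsum_eq_sum_of_fintype] at hsum
  have horb : ∀ ω : orbitRel.Quotient H α, 1 ≤ Nat.card ω.orbit := fun ω => by
    have := ω.nonempty_orbit
    rw [← Set.nonempty_coe_sort] at this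
    exact Nat.card_pos
  calc (p - 1) * (Nat.card H).factorization p
      ≤ (p - 1) * ∑ ω : orbitRel.Quotient H α,
          ((Nat.card ω.orbit).factorial).factorization p := Nat.mul_le_mul_left _ hle
    _ = ∑ ω : orbitRel.Quotient H α,
          (p - 1) * ((Nat.card ω.orbit).factorial).factorization p := Finset.mul_sum _ _ _
    _ ≤ ∑ ω : orbitRel.Quotient H α, (Nat.card ω.orbit - 1) :=
          Finset.sum_le_sum fun ω _ => sub_one_mul_factorization_factorial_le hp _
    _ = Nat.card α - Nat.card (orbitRel.Quotient H α) := by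
          have h2 : ∑ ω : orbitRel.Quotient H α, (Nat.card ω.orbit - 1) +
              ∑ ω : orbitRel.Quotient H α, 1 = ∑ ω : orbitRel.Quotient H α, Nat.card ω.orbit := by
            rw [← Finset.sum_add_distrib]
            exact Finset.sum_congr rfl fun ω _ => Nat.sub_add_cancel (horb ω)
          rw [Finset.sum_const, smul_eq_mul, mul_one, Finset.card_univ, ← Nat.card_eq_fintype_card,
            hsum] at h2
          omega

end general

section perm

variable {α : Type*} [Fintype α]

/-- A subgroup of `Sym(α)` has order dividing `|α|!`. [folklore] -/
theorem card_subgroup_perm_dvd_factorial (H : Subgroup (Perm α)) :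
    Nat.card H ∣ (Fintype.card α).factorial := by
  have := H.card_subgroup_dvd_card
  rwa [Nat.card_perm, Nat.card_eq_fintype_card (α := α)] at this

/-- Every prime divisor of the order of `H ≤ Sym(α)` is at most `|α|`. [folklore] -/
theorem prime_le_card_of_dvd_card (H : Subgroup (Perm α)) {p : ℕ} (hp : p.Prime)
    (hdvd : p ∣ Nat.card H) : p ≤ Fintype.card α :=
  (Nat.Prime.dvd_factorial hp).mp (hdvd.trans (card_subgroup_perm_dvd_factorial H))

/-- For `H ≤ Sym(α)`: `v_p(|H|) ≤ v_p(|α|!) ≤ |α| / (p - 1)`. [folklore] -/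
theorem factorization_card_le_card_div (H : Subgroup (Perm α)) {p : ℕ} (hp : p.Prime) :
    (Nat.card H).factorization p ≤ Fintype.card α / (p - 1) := by
  have h := (Nat.factorization_le_iff_dvd Nat.card_pos.ne' (Nat.factorial_ne_zero _)).mpr
    (card_subgroup_perm_dvd_factorial H) p
  exact h.trans (Nat.factorization_factorial_le_div_pred hp _)

/-- **Order bound from orbits** for permutation groups: if `H ≤ Sym(α)` has `r` orbits on the
finite set `α`, then `(p - 1) · v_p(|H|) ≤ |α| - r` for every prime `p`. [folklore] -/
theorem sub_one_mul_factorization_card_le_perm (H : Subgroup (Perm α)) {p : ℕ} (hp : p.Prime) :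
    (p - 1) * (Nat.card H).factorization p ≤
      Fintype.card α - Nat.card (orbitRel.Quotient H α) := by
  have := sub_one_mul_factorization_card_le (H := H) (α := α) hp
  rwa [Nat.card_eq_fintype_card (α := α)] at this

end perm

end Literature.GroupTheory.PermutationGroups
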